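import Summits.CriticalPhenomena.Ising3D.TaylorGermOneVar
import Summits.CriticalPhenomena.Ising3D.TaylorGermDoubleSum
import Mathlib.Analysis.SpecialFunctions.Pow.Real
import Mathlib.Tactic.Linarith
import Mathlib.Tactic.Positivity
import Mathlib.Tactic.Ring
import Mathlib.Tactic.FieldSimp
import HarnessLib

/-!
# The Taylor germ of a crossing term `F^{s}_±[g]` at a diagonal point, with a block-VALUE majorant
(cell `pub-ising3x`, seat boot-1; gate (g0) of the M3-γ milestone, part 3c)

HONEST FRAMING: lottery ticket; floor = tightest certified 3D Ising CFT bounds; no exact-solution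
claim without a proof.

For a function of block shape `g(z,z̄) = (z z̄)^τ K(z,z̄)` on the open square, `τ ≥ 0`, `K` a double
power series on the unit bidisk with coefficient array `k` (`IsDoublePowerSeriesOn k K` — the shape of
EVERY typed block `hrBlock`/`hrBlockAB`), the crossing combination
`crossF s σ g = ((1-z)(1-z̄))^s g(z,z̄) + σ (z z̄)^s g(1-z,1-z̄)` has a Taylor germ at the diagonal point
`(x, x)`, `0 < x < 1`, of radius `x(1-x)`, whose majorant at radius `ρ < x(1-x)` is bounded by
  `C₁(s,x,ρ) · X₁^τ X₁^τ ∑ |k_{mn}| X₁^{m+n} + |σ| C₂(s,x,ρ) · X₂^τ X₂^τ ∑ |k_{mn}| X₂^{m+n}`,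
  `X₁ = x²/(x-ρ)`, `X₂ = (1-x)²/(1-x-ρ)` (both `< 1`),
with `C₁, C₂` INDEPENDENT of `(τ, k)` (`crossF_germ_majorant`). For a non-negative array the two sums
are the VALUES `g(X₁,X₁)`, `g(X₂,X₂)` — so over a spectrum the majorants are summable against the OPE
weights by the A1 convergence clause (part 3d). Ingredients: the one-variable germs and exponent-uniform
majorants of `TaylorGermOneVar`, the re-expansion lemma `hasTaylorGerm_doubleSum`.
Sources: elementary; the block shape is Hogervorst–Rychkov 2013 §2 / Dolan–Osborn 2004 §3 as typed in
`…ConformalBootstrap3D.BlockExistence(AB)`.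
-/

namespace Summit.CriticalPhenomena.Ising3D

open Finset Set
open Literature.MathematicalPhysics.QuantumFieldTheory.ConformalBootstrap3D

/-- Shrinking the radius of a one-variable germ. [folklore] -/
theorem HasGerm1.mono {u : ℝ → ℝ} {x₀ r r' : ℝ} {c : ℕ → ℝ} (hu : HasGerm1 u x₀ r c)
    (hr' : 0 < r') (hle : r' ≤ r) : HasGerm1 u x₀ r' c :=
  ⟨hr', fun h hh => hu.2 h (lt_of_lt_of_le hh hle)⟩

/-! ### The shifted diagonal points and the constants -/

/-- `X₁(x,t) = x²/(x-t)`: the diagonal point whose block value dominates the `v^s g` term. [folklore] -/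
noncomputable def bgX₁ (x t : ℝ) : ℝ := x ^ 2 / (x - t)

/-- `X₂(x,t) = (1-x)²/(1-x-t)`: the point dominating the `u^s g(1-z,1-z̄)` term. [folklore] -/
noncomputable def bgX₂ (x t : ℝ) : ℝ := (1 - x) ^ 2 / (1 - x - t)

/-- `C₁(s,x,t) = (∑ |oneSubGerm s x i| t^i)²`. [folklore] -/
noncomputable def bgC₁ (s x t : ℝ) : ℝ := (∑' i, |oneSubGerm s x i| * t ^ i) ^ 2

/-- `C₂(s,x,t) = (∑ |rpowGerm s x i| t^i)²`. [folklore] -/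
noncomputable def bgC₂ (s x t : ℝ) : ℝ := (∑' i, |rpowGerm s x i| * t ^ i) ^ 2

/-- `x(1-x) ≤ x`. [folklore] -/
theorem radius_le_left (x : ℝ) : x * (1 - x) ≤ x := by nlinarith [sq_nonneg x]

/-- `x(1-x) ≤ 1-x`. [folklore] -/
theorem radius_le_right (x : ℝ) : x * (1 - x) ≤ 1 - x := by nlinarith [sq_nonneg (1 - x)]

/-- `0 < X₁ < 1` for `t < x(1-x)`, `x > 0`. [folklore] -/
theorem bgX₁_pos_lt {x t : ℝ} (hx0 : 0 < x) (ht : t < x * (1 - x)) :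
    0 < bgX₁ x t ∧ bgX₁ x t < 1 := by
  have h1 : t < x := lt_of_lt_of_le ht (radius_le_left x)
  have h2 : 0 < x - t := by linarith
  refine ⟨div_pos (by positivity) h2, ?_⟩
  rw [bgX₁, div_lt_one h2]
  nlinarith

/-- `0 < X₂ < 1` for `t < x(1-x)`, `x < 1`. [folklore] -/
theorem bgX₂_pos_lt {x t : ℝ} (hx1 : x < 1) (ht : t < x * (1 - x)) :
    0 < bgX₂ x t ∧ bgX₂ x t < 1 := by
  have h1 : t < 1 - x := lt_of_lt_of_le ht (radius_le_right x)
  have h2 : 0 < 1 - x - t := by linarith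
  have h3 : 0 < 1 - x := by linarith
  refine ⟨div_pos (by positivity) h2, ?_⟩
  rw [bgX₂, div_lt_one h2]
  nlinarith

/-! ### The factor germs of the two terms -/

/-- Germ of `z ↦ (1-z)^s z^{α}` at `x`, radius `x(1-x)`, `α ≥ 0`, with the exponent-uniform
majorant `∑ |c_a| t^a ≤ (∑ |oneSubGerm s x i| t^i) · X₁(x,t)^α`. [folklore] -/
theorem hasGerm1_factor₁ {x : ℝ} (hx0 : 0 < x) (hx1 : x < 1) (s : ℝ) {α : ℝ} (hα : 0 ≤ α) :
    HasGerm1 (fun z => (1 - z) ^ s * z ^ α) x (x * (1 - x))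
      (fun n => ∑ ij ∈ antidiagonal n, oneSubGerm s x ij.1 * rpowGerm α x ij.2) ∧
    ∀ t, 0 ≤ t → t < x * (1 - x) →
      ∑' n, |∑ ij ∈ antidiagonal n, oneSubGerm s x ij.1 * rpowGerm α x ij.2| * t ^ n ≤
        (∑' i, |oneSubGerm s x i| * t ^ i) * bgX₁ x t ^ α := by
  have hr : 0 < x * (1 - x) := mul_pos hx0 (by linarith)
  have hu := (hasGerm1_oneSub_rpow s hx1).mono hr (radius_le_right x)
  have hv := (hasGerm1_rpow α hx0).mono hr (radius_le_left x)
  refine ⟨hu.mul hv, fun t ht0 ht => ?_⟩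
  refine (hu.tsum_abs_mul_le hv ht0 ht).trans ?_
  have htx : t < x := lt_of_lt_of_le ht (radius_le_left x)
  exact mul_le_mul_of_nonneg_left (tsum_abs_rpowGerm_le hα hx0 ht0 htx)
    (tsum_nonneg fun i => by positivity)

/-- Germ of `z ↦ z^s (1-z)^{α}` at `x`, radius `x(1-x)`, `α ≥ 0`, with the majorant
`∑ |c_a| t^a ≤ (∑ |rpowGerm s x i| t^i) · X₂(x,t)^α`. [folklore] -/
theorem hasGerm1_factor₂ {x : ℝ} (hx0 : 0 < x) (hx1 : x < 1) (s : ℝ) {α : ℝ} (hα : 0 ≤ α) :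
    HasGerm1 (fun z => z ^ s * (1 - z) ^ α) x (x * (1 - x))
      (fun n => ∑ ij ∈ antidiagonal n, rpowGerm s x ij.1 * oneSubGerm α x ij.2) ∧
    ∀ t, 0 ≤ t → t < x * (1 - x) →
      ∑' n, |∑ ij ∈ antidiagonal n, rpowGerm s x ij.1 * oneSubGerm α x ij.2| * t ^ n ≤
        (∑' i, |rpowGerm s x i| * t ^ i) * bgX₂ x t ^ α := by
  have hr : 0 < x * (1 - x) := mul_pos hx0 (by linarith)
  have hu := (hasGerm1_rpow s hx0).mono hr (radius_le_left x)
  have hv := (hasGerm1_oneSub_rpow α hx1).mono hr (radius_le_right x)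
  refine ⟨hu.mul hv, fun t ht0 ht => ?_⟩
  refine (hu.tsum_abs_mul_le hv ht0 ht).trans ?_
  have htx : t < 1 - x := lt_of_lt_of_le ht (radius_le_right x)
  exact mul_le_mul_of_nonneg_left (tsum_abs_oneSubGerm_le hα hx1 ht0 htx)
    (tsum_nonneg fun i => by positivity)


/-! ### The two terms of `crossF` -/

section Terms

variable {k : ℕ × ℕ → ℝ} {K g : ℝ → ℝ → ℝ} {τ x : ℝ}

/-- The double power series at a point of the bidisk, as a `HasSum`. [folklore] -/
theorem hasSum_of_isDoublePowerSeriesOn (hK : IsDoublePowerSeriesOn k K) {z zb : ℝ} (hz : |z| < 1)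
    (hzb : |zb| < 1) : HasSum (fun p : ℕ × ℕ => k p * z ^ p.1 * zb ^ p.2) (K z zb) := by
  obtain ⟨habs, hval⟩ := hK z zb hz hzb
  have hs : Summable (fun p : ℕ × ℕ => k p * z ^ p.1 * zb ^ p.2) :=
    Summable.of_norm_bounded habs fun p => le_of_eq (by
      rw [Real.norm_eq_abs, abs_mul, abs_mul, abs_pow, abs_pow])
  rw [hval]
  exact hs.hasSum

/-- Summability of `|k| X^m X'^n` at two radii in `[0,1)`. [folklore] -/
theorem summable_abs_of_isDoublePowerSeriesOn (hK : IsDoublePowerSeriesOn k K) {X X' : ℝ}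
    (hX0 : 0 ≤ X) (hX1 : X < 1) (hX'0 : 0 ≤ X') (hX'1 : X' < 1) :
    Summable (fun p : ℕ × ℕ => |k p| * X ^ p.1 * X' ^ p.2) := by
  have h := (hK X X' (by rwa [abs_of_nonneg hX0]) (by rwa [abs_of_nonneg hX'0])).1
  simpa only [abs_of_nonneg hX0, abs_of_nonneg hX'0] using h

/-- Points `x + h`, `|h| < x(1-x)`, lie in `(0,1)`. [folklore] -/
theorem mem_Ioo_of_abs_lt {h : ℝ} (hh : |h| < x * (1 - x)) : x + h ∈ Ioo (0 : ℝ) 1 := by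
  have h1 := radius_le_left x
  have h2 := radius_le_right x
  rw [abs_lt] at hh
  exact ⟨by linarith, by linarith⟩

/-- **Term 1**: `((1-z)(1-z̄))^s g(z,z̄)` has the germ `dsCoeff k c₁ c₁` at `(x,x)` with majorant
`≤ C₁ · X₁^τ X₁^τ ∑|k| X₁^{m+n}`. [folklore] -/
theorem hasTaylorGerm_term₁ (hK : IsDoublePowerSeriesOn k K) (hτ : 0 ≤ τ) (hx0 : 0 < x)
    (hx1 : x < 1)
    (hg : ∀ z zb : ℝ, z ∈ Ioo (0 : ℝ) 1 → zb ∈ Ioo (0 : ℝ) 1 → g z zb = (z * zb) ^ τ * K z zb)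
    (s : ℝ) :
    HasTaylorGerm (fun z zb => ((1 - z) * (1 - zb)) ^ s * g z zb) x x (x * (1 - x))
      (dsCoeff k (fun m n => ∑ ij ∈ antidiagonal n, oneSubGerm s x ij.1 * rpowGerm (τ + m) x ij.2)
        (fun m n => ∑ ij ∈ antidiagonal n, oneSubGerm s x ij.1 * rpowGerm (τ + m) x ij.2)) ∧
    ∀ t, 0 ≤ t → t < x * (1 - x) →
      Summable (fun ab : ℕ × ℕ => |dsCoeff k
        (fun m n => ∑ ij ∈ antidiagonal n, oneSubGerm s x ij.1 * rpowGerm (τ + m) x ij.2)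
        (fun m n => ∑ ij ∈ antidiagonal n, oneSubGerm s x ij.1 * rpowGerm (τ + m) x ij.2) ab| *
          t ^ ab.1 * t ^ ab.2) ∧
      ∑' ab : ℕ × ℕ, |dsCoeff k
        (fun m n => ∑ ij ∈ antidiagonal n, oneSubGerm s x ij.1 * rpowGerm (τ + m) x ij.2)
        (fun m n => ∑ ij ∈ antidiagonal n, oneSubGerm s x ij.1 * rpowGerm (τ + m) x ij.2) ab| *
          t ^ ab.1 * t ^ ab.2 ≤
        ((∑' i, |oneSubGerm s x i| * t ^ i) * bgX₁ x t ^ τ) *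
          ((∑' i, |oneSubGerm s x i| * t ^ i) * bgX₁ x t ^ τ) *
            ∑' p : ℕ × ℕ, |k p| * bgX₁ x t ^ p.1 * bgX₁ x t ^ p.2 := by
  have hr : 0 < x * (1 - x) := mul_pos hx0 (by linarith)
  -- factor germs, exponent τ + m ≥ 0
  have hfac := fun m : ℕ => hasGerm1_factor₁ hx0 hx1 s (α := τ + m) (by positivity)
  refine hasTaylorGerm_doubleSum (u := fun m h => (1 - (x + h)) ^ s * (x + h) ^ (τ + m))
    (v := fun m h => (1 - (x + h)) ^ s * (x + h) ^ (τ + m))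
    (A := fun t => (∑' i, |oneSubGerm s x i| * t ^ i) * bgX₁ x t ^ τ)
    (B := fun t => (∑' i, |oneSubGerm s x i| * t ^ i) * bgX₁ x t ^ τ)
    (X := bgX₁ x) (Y := bgX₁ x) hr ?_ ?_ ?_ ?_ ?_ ?_
  · intro m h hh
    exact (hfac m).1.hasSum hh
  · intro m t ht0 ht
    refine ⟨(hfac m).1.summable_abs ht0 ht, ((hfac m).2 t ht0 ht).trans (le_of_eq ?_)⟩
    rw [Real.rpow_add_natCast (bgX₁_pos_lt hx0 ht).1.ne', mul_assoc]
  · intro m h hh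
    exact (hfac m).1.hasSum hh
  · intro m t ht0 ht
    refine ⟨(hfac m).1.summable_abs ht0 ht, ((hfac m).2 t ht0 ht).trans (le_of_eq ?_)⟩
    rw [Real.rpow_add_natCast (bgX₁_pos_lt hx0 ht).1.ne', mul_assoc]
  · intro t t' _ ht _ ht'
    have h1 := bgX₁_pos_lt hx0 ht
    have h2 := bgX₁_pos_lt hx0 ht'
    exact summable_abs_of_isDoublePowerSeriesOn hK h1.1.le h1.2 h2.1.le h2.2
  · intro h h' hh hh'
    have hz := mem_Ioo_of_abs_lt hh
    have hzb := mem_Ioo_of_abs_lt hh'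
    have hsum := hasSum_of_isDoublePowerSeriesOn hK (z := x + h) (zb := x + h') (by rw [abs_of_pos hz.1]; exact hz.2)
      (by rw [abs_of_pos hzb.1]; exact hzb.2)
    have hval : ((1 - (x + h)) * (1 - (x + h'))) ^ s * g (x + h) (x + h') =
        (1 - (x + h)) ^ s * (1 - (x + h')) ^ s * ((x + h) ^ τ * (x + h') ^ τ) * K (x + h) (x + h') := by
      rw [hg _ _ hz hzb, Real.mul_rpow (by linarith [hz.2]) (by linarith [hzb.2]),
        Real.mul_rpow hz.1.le hzb.1.le]
      ring
    rw [hval]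
    refine (hsum.mul_left ((1 - (x + h)) ^ s * (1 - (x + h')) ^ s *
      ((x + h) ^ τ * (x + h') ^ τ))).congr_fun fun p => ?_
    rw [Real.rpow_add_natCast hz.1.ne', Real.rpow_add_natCast hzb.1.ne']
    ring

/-- **Term 2**: `(z z̄)^s g(1-z,1-z̄)` has the germ `dsCoeff k c₂ c₂` at `(x,x)` with majorant
`≤ C₂ · X₂^τ X₂^τ ∑|k| X₂^{m+n}`. [folklore] -/
theorem hasTaylorGerm_term₂ (hK : IsDoublePowerSeriesOn k K) (hτ : 0 ≤ τ) (hx0 : 0 < x)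
    (hx1 : x < 1)
    (hg : ∀ z zb : ℝ, z ∈ Ioo (0 : ℝ) 1 → zb ∈ Ioo (0 : ℝ) 1 → g z zb = (z * zb) ^ τ * K z zb)
    (s : ℝ) :
    HasTaylorGerm (fun z zb => (z * zb) ^ s * g (1 - z) (1 - zb)) x x (x * (1 - x))
      (dsCoeff k (fun m n => ∑ ij ∈ antidiagonal n, rpowGerm s x ij.1 * oneSubGerm (τ + m) x ij.2)
        (fun m n => ∑ ij ∈ antidiagonal n, rpowGerm s x ij.1 * oneSubGerm (τ + m) x ij.2)) ∧
    ∀ t, 0 ≤ t → t < x * (1 - x) →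
      Summable (fun ab : ℕ × ℕ => |dsCoeff k
        (fun m n => ∑ ij ∈ antidiagonal n, rpowGerm s x ij.1 * oneSubGerm (τ + m) x ij.2)
        (fun m n => ∑ ij ∈ antidiagonal n, rpowGerm s x ij.1 * oneSubGerm (τ + m) x ij.2) ab| *
          t ^ ab.1 * t ^ ab.2) ∧
      ∑' ab : ℕ × ℕ, |dsCoeff k
        (fun m n => ∑ ij ∈ antidiagonal n, rpowGerm s x ij.1 * oneSubGerm (τ + m) x ij.2)
        (fun m n => ∑ ij ∈ antidiagonal n, rpowGerm s x ij.1 * oneSubGerm (τ + m) x ij.2) ab| *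
          t ^ ab.1 * t ^ ab.2 ≤
        ((∑' i, |rpowGerm s x i| * t ^ i) * bgX₂ x t ^ τ) *
          ((∑' i, |rpowGerm s x i| * t ^ i) * bgX₂ x t ^ τ) *
            ∑' p : ℕ × ℕ, |k p| * bgX₂ x t ^ p.1 * bgX₂ x t ^ p.2 := by
  have hr : 0 < x * (1 - x) := mul_pos hx0 (by linarith)
  have hfac := fun m : ℕ => hasGerm1_factor₂ hx0 hx1 s (α := τ + m) (by positivity)
  refine hasTaylorGerm_doubleSum (u := fun m h => (x + h) ^ s * (1 - (x + h)) ^ (τ + m))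
    (v := fun m h => (x + h) ^ s * (1 - (x + h)) ^ (τ + m))
    (A := fun t => (∑' i, |rpowGerm s x i| * t ^ i) * bgX₂ x t ^ τ)
    (B := fun t => (∑' i, |rpowGerm s x i| * t ^ i) * bgX₂ x t ^ τ)
    (X := bgX₂ x) (Y := bgX₂ x) hr ?_ ?_ ?_ ?_ ?_ ?_
  · intro m h hh
    exact (hfac m).1.hasSum hh
  · intro m t ht0 ht
    refine ⟨(hfac m).1.summable_abs ht0 ht, ((hfac m).2 t ht0 ht).trans (le_of_eq ?_)⟩
    rw [Real.rpow_add_natCast (bgX₂_pos_lt hx1 ht).1.ne', mul_assoc]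
  · intro m h hh
    exact (hfac m).1.hasSum hh
  · intro m t ht0 ht
    refine ⟨(hfac m).1.summable_abs ht0 ht, ((hfac m).2 t ht0 ht).trans (le_of_eq ?_)⟩
    rw [Real.rpow_add_natCast (bgX₂_pos_lt hx1 ht).1.ne', mul_assoc]
  · intro t t' _ ht _ ht'
    have h1 := bgX₂_pos_lt hx1 ht
    have h2 := bgX₂_pos_lt hx1 ht'
    exact summable_abs_of_isDoublePowerSeriesOn hK h1.1.le h1.2 h2.1.le h2.2
  · intro h h' hh hh'
    have hz := mem_Ioo_of_abs_lt hh
    have hzb := mem_Ioo_of_abs_lt hh'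
    have hz' : 1 - (x + h) ∈ Ioo (0 : ℝ) 1 := ⟨by linarith [hz.2], by linarith [hz.1]⟩
    have hzb' : 1 - (x + h') ∈ Ioo (0 : ℝ) 1 := ⟨by linarith [hzb.2], by linarith [hzb.1]⟩
    have hsum := hasSum_of_isDoublePowerSeriesOn hK (z := 1 - (x + h)) (zb := 1 - (x + h'))
      (by rw [abs_of_pos hz'.1]; exact hz'.2) (by rw [abs_of_pos hzb'.1]; exact hzb'.2)
    have hval : ((x + h) * (x + h')) ^ s * g (1 - (x + h)) (1 - (x + h')) =
        (x + h) ^ s * (x + h') ^ s * ((1 - (x + h)) ^ τ * (1 - (x + h')) ^ τ) *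
          K (1 - (x + h)) (1 - (x + h')) := by
      rw [hg _ _ hz' hzb', Real.mul_rpow hz.1.le hzb.1.le, Real.mul_rpow hz'.1.le hzb'.1.le]
      ring
    rw [hval]
    refine (hsum.mul_left ((x + h) ^ s * (x + h') ^ s *
      ((1 - (x + h)) ^ τ * (1 - (x + h')) ^ τ))).congr_fun fun p => ?_
    rw [Real.rpow_add_natCast hz'.1.ne', Real.rpow_add_natCast hzb'.1.ne']
    ring

/-- **The germ of `crossF s σ g` at `(x,x)` with its block-value majorant.** There are a
coefficient array `T` and a majorant `N = ∑ |T_{ab}| ρ^{a+b}` with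
`N ≤ C₁ X₁^τ X₁^τ ∑|k| X₁^{m+n} + |σ| C₂ X₂^τ X₂^τ ∑ |k| X₂^{m+n}` (`C₁ = bgC₁ s x ρ`,
`C₂ = bgC₂ s x ρ`, `Xᵢ = bgXᵢ x ρ`), constants independent of `τ` and `k`. [folklore] -/
theorem crossF_germ_majorant (hK : IsDoublePowerSeriesOn k K) (hτ : 0 ≤ τ) (hx0 : 0 < x)
    (hx1 : x < 1)
    (hg : ∀ z zb : ℝ, z ∈ Ioo (0 : ℝ) 1 → zb ∈ Ioo (0 : ℝ) 1 → g z zb = (z * zb) ^ τ * K z zb)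
    (s σ : ℝ) {ρ : ℝ} (hρ0 : 0 < ρ) (hρ : ρ < x * (1 - x)) :
    ∃ (T : ℕ × ℕ → ℝ) (N : ℝ), HasTaylorGerm (crossF s σ g) x x (x * (1 - x)) T ∧
      HasSum (fun p : ℕ × ℕ => |T p| * ρ ^ p.1 * ρ ^ p.2) N ∧
      N ≤ bgC₁ s x ρ * (bgX₁ x ρ ^ τ * bgX₁ x ρ ^ τ *
              ∑' p : ℕ × ℕ, |k p| * bgX₁ x ρ ^ p.1 * bgX₁ x ρ ^ p.2) +
          |σ| * (bgC₂ s x ρ * (bgX₂ x ρ ^ τ * bgX₂ x ρ ^ τ *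
              ∑' p : ℕ × ℕ, |k p| * bgX₂ x ρ ^ p.1 * bgX₂ x ρ ^ p.2)) := by
  obtain ⟨hG₁, hM₁⟩ := hasTaylorGerm_term₁ hK hτ hx0 hx1 hg s
  obtain ⟨hG₂, hM₂⟩ := hasTaylorGerm_term₂ hK hτ hx0 hx1 hg s
  obtain ⟨hS₁, hB₁⟩ := hM₁ ρ hρ0.le hρ
  obtain ⟨hS₂, hB₂⟩ := hM₂ ρ hρ0.le hρ
  set T₁ := dsCoeff k (fun m n => ∑ ij ∈ antidiagonal n, oneSubGerm s x ij.1 * rpowGerm (τ + m) x ij.2)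
    (fun m n => ∑ ij ∈ antidiagonal n, oneSubGerm s x ij.1 * rpowGerm (τ + m) x ij.2) with hT₁
  set T₂ := dsCoeff k (fun m n => ∑ ij ∈ antidiagonal n, rpowGerm s x ij.1 * oneSubGerm (τ + m) x ij.2)
    (fun m n => ∑ ij ∈ antidiagonal n, rpowGerm s x ij.1 * oneSubGerm (τ + m) x ij.2) with hT₂
  have hsum := hG₁.add (hG₂.smul σ)
  have hfun : ((fun z zb => ((1 - z) * (1 - zb)) ^ s * g z zb) +
      σ • fun z zb => (z * zb) ^ s * g (1 - z) (1 - zb)) = crossF s σ g := by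
    funext z zb
    simp only [Pi.add_apply, Pi.smul_apply, smul_eq_mul, crossF]
    ring
  rw [hfun] at hsum
  -- the majorant of `T₁ + σ • T₂`
  have hdom : ∀ p : ℕ × ℕ, |(T₁ + σ • T₂) p| * ρ ^ p.1 * ρ ^ p.2 ≤
      |T₁ p| * ρ ^ p.1 * ρ ^ p.2 + |σ| * (|T₂ p| * ρ ^ p.1 * ρ ^ p.2) := fun p => by
    have hρp : 0 ≤ ρ ^ p.1 * ρ ^ p.2 := by positivity
    have h1 : |T₁ p + σ * T₂ p| ≤ |T₁ p| + |σ| * |T₂ p| := by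
      calc |T₁ p + σ * T₂ p| ≤ |T₁ p| + |σ * T₂ p| := abs_add_le _ _
        _ = _ := by rw [abs_mul]
    calc |(T₁ + σ • T₂) p| * ρ ^ p.1 * ρ ^ p.2 = |T₁ p + σ * T₂ p| * (ρ ^ p.1 * ρ ^ p.2) := by
          simp only [Pi.add_apply, Pi.smul_apply, smul_eq_mul, mul_assoc]
      _ ≤ (|T₁ p| + |σ| * |T₂ p|) * (ρ ^ p.1 * ρ ^ p.2) := mul_le_mul_of_nonneg_right h1 hρp
      _ = _ := by ring
  have hmaj : Summable fun p : ℕ × ℕ => |T₁ p| * ρ ^ p.1 * ρ ^ p.2 + |σ| * (|T₂ p| * ρ ^ p.1 * ρ ^ p.2) :=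
    hS₁.add (hS₂.mul_left _)
  have hS : Summable fun p : ℕ × ℕ => |(T₁ + σ • T₂) p| * ρ ^ p.1 * ρ ^ p.2 :=
    hmaj.of_nonneg_of_le (fun p => by positivity) hdom
  refine ⟨T₁ + σ • T₂, ∑' p : ℕ × ℕ, |(T₁ + σ • T₂) p| * ρ ^ p.1 * ρ ^ p.2, hsum, hS.hasSum, ?_⟩
  have h1 : ∑' p : ℕ × ℕ, |(T₁ + σ • T₂) p| * ρ ^ p.1 * ρ ^ p.2 ≤
      ∑' p : ℕ × ℕ, |T₁ p| * ρ ^ p.1 * ρ ^ p.2 + |σ| * ∑' p : ℕ × ℕ, |T₂ p| * ρ ^ p.1 * ρ ^ p.2 := by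
    rw [← tsum_mul_left, ← hS₁.tsum_add (hS₂.mul_left _)]
    exact hS.tsum_le_tsum hdom hmaj
  refine h1.trans (add_le_add ?_ (mul_le_mul_of_nonneg_left ?_ (abs_nonneg σ)))
  · refine hB₁.trans (le_of_eq ?_)
    rw [bgC₁]; ring
  · refine hB₂.trans (le_of_eq ?_)
    rw [bgC₂]; ring

end Terms

end Summit.CriticalPhenomena.Ising3D
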